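import Literature.MathematicalPhysics.QuantumManyBody.DiluteBoseGasUpperBoundGrandCanonical
import Literature.MathematicalPhysics.QuantumManyBody.DiluteBoseGasLHYUpperBoundProofs
import HarnessLib

/-!
# Basti–Cenatiempo–Schlein 2021, Thm. 1.1 (Lee–Huang–Yang upper bound): decomposition — what is left is Prop. 1.3

Topic `Literature/MathematicalPhysics/QuantumManyBody`, namespace `BoseGas`.  G. Basti,
S. Cenatiempo, B. Schlein, *A new second-order upper bound for the ground state energy of dilute
Bose gases*, Forum Math. Sigma 9 (2021) e74 (arXiv:2101.06222) prove Theorem 1.1 — the tree's named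
facts `BCS2021_lhyUpperBound_dirichlet` (`DiluteBoseGasLHYUpperBound.lean`) and
`BastiCenatiempoSchlein2021_upperBound` (`DiluteBoseGasUpperBound.lean`), two renderings proved
equivalent in `DiluteBoseGasLHYUpperBoundProofs.lean` — from exactly two propositions (p. 3,
"Theorem 1.1 follows by combining Prop. 1.2 and Prop. 1.3"): **Prop. 1.2** (App. A: localisation
of a torus Fock state into Dirichlet boxes, replication, and the passage to the thermodynamic
limit) and **Prop. 1.3** (§§2–5: the grand-canonical Bogoliubov–cubic trial state on the torus of
side `L = ρ̃^{-γ}`).  Prop. 1.2 together with the "Proof of Theorem 1.1" bookkeeping at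
`(γ, ε) = (11/10, 1/10)` is a THEOREM of the tree
(`BastiCenatiempoSchlein2021_upperBound_of_grandCanonicalLHYBlocks`,
`DiluteBoseGasUpperBoundGrandCanonical.lean`, with `DiluteBoseGasUpperBoundLocalization.lean` and
`DiluteBoseGasUpperBoundProofs.lean`: Lemmas A.1–A.4 for the tree's variational objects).  Hence
the decomposition of the parent has ONE unproved child, stated here as a named fact in the exact
shape that theorem consumes:

* `BastiCenatiempoSchlein2021_trialState` — **Prop. 1.3 at `γ = 11/10`, `ε = 1/10`**, read
  through the sector weights `c_n = ‖Ψ^{(n)}‖²` of the torus Fock state `Ψ`.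

Assemblies: `BastiCenatiempoSchlein2021_upperBound_holds_of` and
`BCS2021_lhyUpperBound_dirichlet_holds_of`.  The child does not restate the parent: it is a
statement about one grand-canonical state on one periodic box per density (number moments and
energy), whereas the parent is the canonical Dirichlet thermodynamic limit; the implication is
the whole of App. A.

## References

* [BastiCenatiempoSchlein2021] G. Basti, S. Cenatiempo, B. Schlein, Forum Math. Sigma 9 (2021)
  e74 (arXiv:2101.06222): Thm. 1.1, (1.4)–(1.8), Prop. 1.2, Prop. 1.3 and "Proof of Theorem 1.1"
  (pp. 3–5 of the arXiv text), App. A.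
-/

noncomputable section

open MeasureTheory Filter Metric
open scoped ENNReal NNReal

namespace Literature.MathematicalPhysics.QuantumManyBody.BoseGas

/-- **Basti–Cenatiempo–Schlein 2021, Proposition 1.3** (arXiv:2101.06222, p. 4), at the paper's
final choice of parameters `γ = 11/10`, `ε = 1/10` ("Proof of Theorem 1.1", p. 5): "Let `V` be as
in Theorem 1.1 [`V ∈ L³(ℝ³)` non-negative, radial, `supp V ⊂ B_R(0)`, scattering length `𝔞 ≤ R`].
For every `γ > 1` and `ε > 0` small enough there are `C > 0` and, for every `ρ̃ > 0` small
enough, a normalised `Ψ ∈ 𝓕(Λ_L)` on the torus `Λ_L`, `L = ρ̃^{-γ}`, with `⟨Ψ, 𝒩Ψ⟩ ≥ ρ̃L³`,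
`⟨Ψ, 𝒩²Ψ⟩ ≤ C ρ̃² L⁶` and
`⟨Ψ, 𝓗Ψ⟩ ≤ 4π𝔞ρ̃² L³ (1 + (128/(15√π)) √(ρ̃𝔞³)) + C ρ̃^{5/2+ε} L³`" (periodic Hamiltonian
`𝓗 = ⊕ₙ H_L^{per,(n)}`).  Rendering, for the tree's variational objects and WEAKER than the
print: the state enters only through its sector weights `c_n = ‖Ψ^{(n)}‖²` (`∑ c_n = 1`), its
number moments `∑ n c_n ≥ ρ̃L³`, `∑ n² c_n ≤ K (ρ̃L³)²`, and the sector-wise variational bound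
`∑ c_n E₀^per(n, L) ≤ ⟨Ψ, 𝓗Ψ⟩` (`E₀^per = periodicGroundStateEnergy`, the bottom of the
`n`-particle periodic form, below `⟨Ψ^{(n)}, H Ψ^{(n)}⟩/‖Ψ^{(n)}‖²`), with one constant `K`
for both bounds; `lhyConstant = 128/(15√π)`; the class of potentials is that of
`BastiCenatiempoSchlein2021_upperBound` (`v` measurable, `v = 0` beyond `R`, `∫ v(|x|)³ < ∞`,
`𝔞 ≤ R`).  This is verbatim the hypothesis `hblocks` of
`BastiCenatiempoSchlein2021_upperBound_of_grandCanonicalLHYBlocks`.  Its printed proof is §§2–5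
of the paper (the Bogoliubov transformation `T(η)`, the cubic operator `A`, Props. 2.2–2.5,
Lemma 5.1). [cite: BastiCenatiempoSchlein2021, Prop. 1.3 (p. 4) with γ = 11/10, ε = 1/10 (Proof of Thm. 1.1, p. 5)] -/
def BastiCenatiempoSchlein2021_trialState : Prop :=
  ∀ (v : ℝ → ℝ≥0∞) (R : ℝ), Measurable v → (∀ r, R < r → v r = 0) →
    (∫⁻ x : Space, v ‖x‖ ^ 3) ≠ ⊤ → scatteringLength v ≤ ENNReal.ofReal R →
    ∃ K ρ₁ : ℝ, 0 < K ∧ 0 < ρ₁ ∧ ∀ ρt : ℝ, 0 < ρt → ρt < ρ₁ →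
      ∃ c : ℕ → ℝ≥0∞, ∑' n, c n = 1 ∧
        ENNReal.ofReal (ρt * (ρt ^ (-(11 : ℝ) / 10)) ^ 3) ≤ ∑' n : ℕ, (n : ℝ≥0∞) * c n ∧
        ∑' n : ℕ, (n : ℝ≥0∞) ^ 2 * c n ≤
          ENNReal.ofReal (K * (ρt * (ρt ^ (-(11 : ℝ) / 10)) ^ 3) ^ 2) ∧
        ∑' n : ℕ, c n * periodicGroundStateEnergy v n (ρt ^ (-(11 : ℝ) / 10)) ≤
          ENNReal.ofReal ((4 * Real.pi * (scatteringLength v).toReal * ρt ^ 2 *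
              (1 + lhyConstant * Real.sqrt (ρt * (scatteringLength v).toReal ^ 3)) +
            K * ρt ^ ((5 : ℝ) / 2 + 1 / 10)) * (ρt ^ (-(11 : ℝ) / 10)) ^ 3)

/-- **Assembly: Theorem 1.1 (rendering `BastiCenatiempoSchlein2021_upperBound`) from Prop. 1.3**,
Prop. 1.2 and the "Proof of Theorem 1.1" being the landed
`BastiCenatiempoSchlein2021_upperBound_of_grandCanonicalLHYBlocks`.
[cite: BastiCenatiempoSchlein2021, Thm. 1.1, "follows by combining Prop. 1.2 and Prop. 1.3" (p. 3)] -/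
theorem BastiCenatiempoSchlein2021_upperBound_holds_of :
    BastiCenatiempoSchlein2021_trialState → BastiCenatiempoSchlein2021_upperBound :=
  fun h => BastiCenatiempoSchlein2021_upperBound_of_grandCanonicalLHYBlocks h

/-- **Assembly: Theorem 1.1 (rendering `BCS2021_lhyUpperBound_dirichlet`) from Prop. 1.3**, via
`BastiCenatiempoSchlein2021_upperBound_holds_of` and the equivalence of the two renderings
(`BCS2021_lhyUpperBound_dirichlet_of_upperBound`). [cite: BastiCenatiempoSchlein2021, Thm. 1.1] -/
theorem BCS2021_lhyUpperBound_dirichlet_holds_of :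
    BastiCenatiempoSchlein2021_trialState → BCS2021_lhyUpperBound_dirichlet :=
  fun h => BCS2021_lhyUpperBound_dirichlet_of_upperBound
    (BastiCenatiempoSchlein2021_upperBound_holds_of h)

end Literature.MathematicalPhysics.QuantumManyBody.BoseGas
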